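import Summits.ABC.IUTFork.LDHSlotResidueUnionPerImage
import Summits.ABC.IUTFork.LDHLocalProofData
import HarnessLib

/-!
# The fork at [IUTchIII] Corollary 3.12, L-DH level: the v4 REGIME binder `hreg` read on the closed per-image line — slot-constancy of
# the pilot data IS constancy of abc-iut-c312-d1's canonical `log(q_v)`, and `hreg` ⟺ (±E) «(ii′-P) at every datum with the constant
# lowered by the slot residue» (abc-iut cell; crux ThetaPartII = stmt-ABC-19678; `hreg` of `Conditional/AbcOfSGenuineRegime.lean` v4)

Record-only PROOF file (D-0012) of the abc-iut cell (R2 S-chain seat abc-iut-s2-p2; sequel to `LDHSlotResidueUnionPerImage.lean`).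
TAKES NO SIDE on [IUTchIII] Cor. 3.12 or on the (U)/(P) readings. Mochizuki, *IUT IV* [Mochizuki2012] Def. 1.9 (ii) p. 22, Thm. 1.10
p. 23 (`log(q_v)`), proof Step (v) p. 27–28; Dupuy–Hilado [DupuyHilado2025] §3.3 (`P_q = 𝔮/(2l)`, `P_{Θ,j} = j²·P_q`), §4.7, §4.11–4.12.

The line of record `abc_of_S_v4` (p431657) carries the CONE binder `hreg`: the union hull estimate with print's `B_III(λ,l)` demanded ONLY at
data which are NOT slot-constant in abc-iut-c312-d1's vocabulary (`(DHData.ofInput T.I).logQloc p v` constant over the places of `F_mod` above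
each support prime). THIS FILE:
* `DHData.slotValue_eq_mul_logQloc` — `θ_j(v) = (j²/(2l))·log(q_v)` (abc-iut-S8's `PilotData.slotValue` vs c312-d1's `DHData.logQloc`);
  `DHData.slotConstantAt_iff_logQloc_const` — at a prime `p`: «`θ_j` constant on `V(F)_p` for every `j`» ⟺ «`log(q_v)` constant on `V(F)_p`»;
* **`PointDict.perImageLowered_of_hullRegimeAt`** — at admissible `(P, l)` (`λ ∈ U_P` minimal, `l` prime `≥ 5`, (P6)): the `hreg` body AT
  `(P, l)` implies, for EVERY datum `T` (regime or not), the PER-IMAGE estimate with constant `B_III(P,l) − slotResidue(T) + E(P,l)`,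
  `E(P,l) = 2·d_mod·(log-diff + log-cond) + log(2·3·5·l)` — at slot-constant data the residue is `0` and the closed line (p425589) serves; at the
  others `hreg` gives the union estimate and this seat's identity (U) = (P) + residue ± `Σ_{T(I)} log p` lowers the constant;
* **`PointDict.hullRegimeAt_of_perImageLowered`** — conversely «(ii′-P) at every datum with constant `B_III − slotResidue(T) − E(P,l)`» gives the
  union estimate at EVERY datum (a fortiori the `hreg` body);
* **`Conditional.perImageLowered_of_hreg`** / **`Conditional.hreg_of_perImageLowered`** — the same for the v4 binder VERBATIM (all admissible
  `(P, l)`): `hreg` sits between the two per-image statements with constants `B_III − slotResidue(T) ∓ E(P,l)`.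
READING (for the C lead; nothing asserted about print): v4's open CONE binder is, up to `±E(P,l)`, the statement that the CLOSED per-image
constant `B_III` improves by the datum's (Ind1) slot residue (= the mixed `log(q)`-share, `LDHSlotResidueMixedShare`) at every genuine datum of
every admissible Legendre point — a Szpiro/abc-type condition on the point; claimed in neither direction. PROOF-ONLY: 0 definitions, no `Prop`
facts; typed ≠ proved. [cite: Mochizuki2012, IUTchIV Def. 1.9 (ii) p. 22; Thm. 1.10 proof Steps (ii)–(viii) p. 24–31]
[cite: DupuyHilado2025, §3.3, §4.7, §4.11, §4.12] [claim: Mochizuki2012, status: disputed] for every IUT quotation.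
-/

noncomputable section

namespace Summit.ABC.IUTFork

open Literature.IUT.LogVolume Literature.IUT.HodgeTheaters Literature.NumberTheory.DiophantineGeometry.GenEll
open NumberField IsDedekindDomain

/-! ## Slot values versus the canonical `log(q_v)` -/

namespace DHData

variable {F : Type} [Field F] [NumberField F] (D : DHData F)

/-- **`θ_j(v) = (j²/(2l))·log(q_v)`**: abc-iut-S8's slot value is c312-d1's canonical `log(q_v) = 𝔮(v)·ln N(v)/n_v` scaled by the procession
weight (`P_{Θ,j} = j²·P_q = (j²/(2l))·𝔮`). [cite: DupuyHilado2025, §3.3] [cite: Mochizuki2012, IUTchIV Def. 1.9 (ii) p. 22] -/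
theorem slotValue_eq_mul_logQloc (p : ℕ) (i : Fin D.X.lstar) (v : placesOver F p) :
    D.X.slotValue i v.1 = (((i : ℕ) + 1 : ℝ) ^ 2 / (2 * (D.X.l : ℝ))) * D.logQloc p v := by
  rw [PilotData.slotValue_eq_sq_mul, DHData.logQloc, PilotData.qPilot_eq_smul, Finsupp.smul_apply, smul_eq_mul]
  ring

/-- **Slot-constancy at `p` ⟺ constancy of `log(q_v)` over `V(F)_p`** (the `hreg` regime clause of `abc_of_S_v4`, prime by prime).
[cite: Mochizuki2012, IUTchIV Thm. 1.10 Step (v) p. 28] [cite: DupuyHilado2025, §3.3, §4.7] -/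
theorem slotConstantAt_iff_logQloc_const (p : ℕ) :
    (∀ (i : Fin D.X.lstar) (v w : placesOver F p), D.X.slotValue i v.1 = D.X.slotValue i w.1) ↔
      (∀ v w : placesOver F p, D.logQloc p v = D.logQloc p w) := by
  have hl0 : (0 : ℝ) < 2 * (D.X.l : ℝ) := D.X.two_mul_l_pos
  constructor
  · intro h v w
    have h0 : 0 < D.X.lstar := by have := D.X.two_le_lstar; omega
    have h1 := h ⟨0, h0⟩ v w
    rw [D.slotValue_eq_mul_logQloc, D.slotValue_eq_mul_logQloc] at h1
    have hc : (((((⟨0, h0⟩ : Fin D.X.lstar) : ℕ) : ℝ) + 1) ^ 2 / (2 * (D.X.l : ℝ))) ≠ 0 := by positivity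
    exact mul_left_cancel₀ hc h1
  · intro h i v w
    rw [D.slotValue_eq_mul_logQloc, D.slotValue_eq_mul_logQloc, h v w]

end DHData

/-! ## At the `λ`-line: the regime binder on the per-image line -/

namespace PointDict

variable {P : NFPoint} {l : ℕ}

/-- The Step (iii) rounding constant is nonnegative: `0 ≤ Σ_{p∈T(I)} log p ≤ E(P,l)`. [cite: Mochizuki2012, IUTchIV Thm. 1.10 proof Step (iii) p. 26] -/
theorem stepiii_const_nonneg (hP : P ∈ UP) (T : Cor22.ThetaVolumeDatumAt P l) :
    0 ≤ 2 * (Cor22.dmod P : ℝ) * (P.logDiff + Cor22.logCondAvoid P {2, l}) + Real.log (2 * 3 * 5 * (l : ℝ)) := by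
  letI := T.instFieldF; letI := T.instNumberFieldF; letI := T.instFieldK; letI := T.instNumberFieldK
  letI := T.instAlgebraK
  have h2 : ∑ q ∈ T.I.supportPrimes, Real.log (q : ℝ) ≤
      2 * (Cor22.dmod P : ℝ) * (P.logDiff + Cor22.logCondAvoid P {2, l}) + Real.log (2 * 3 * 5 * (l : ℝ)) :=
    T.sum_log_supportPrimes_le_pinned hP
  have h0 : 0 ≤ ∑ q ∈ T.I.supportPrimes, Real.log (q : ℝ) :=
    Finset.sum_nonneg fun q hq => Real.log_nonneg (by exact_mod_cast (T.I.prime_of_mem_supportPrimes hq).one_lt.le)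
  linarith

/-- **The `hreg` body at `(P, l)` ⟹ the per-image estimate with the constant lowered by the residue, at EVERY datum.** At admissible
`(P, l)` (`λ ∈ U_P` minimal, `l` prime `≥ 5`, (P6)): if the union hull estimate with `B_III(P,l)` holds at every datum that is NOT
`log(q_v)`-slot-constant, then EVERY datum `T` satisfies `T.HullEstimatePerImageOf (B_III(P,l) − slotResidue(T) + E(P,l))` — at slot-constant
data the residue vanishes and the CLOSED per-image line (p425589) serves. [cite: Mochizuki2012, IUTchIV Thm. 1.10 proof Steps (ii)–(viii) p. 24–31]
[claim: Mochizuki2012, status: disputed] -/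
theorem perImageLowered_of_hullRegimeAt (hP : P ∈ UP) (hl : l.Prime) (h5 : 5 ≤ l) (h6 : Cor22.CondP6 P l)
    (hregAt : ∀ T : Cor22.ThetaVolumeDatumAt P l,
      (letI := T.instFieldF; letI := T.instNumberFieldF; letI := T.instAlgebraF; letI := T.instFieldK
       letI := T.instNumberFieldK; letI := T.instAlgebraK; letI := T.instFieldFbar; letI := T.instAlgebraFbar
       letI := T.instAlgebraKFbar; letI := T.instIsElliptic
       ¬ (∀ p ∈ T.I.supportPrimes, ∀ v w : placesOver (fieldOfModuli T.E) p,
          (DHData.ofInput T.I).logQloc p v = (DHData.ofInput T.I).logQloc p w)) →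
      T.HullEstimateOf
        (((l : ℝ) + 1) / 4 *
          ((1 + 12 * (Cor22.dmod P : ℝ) / l) * (P.logDiff + Cor22.logCondAvoid P {2, l})
            + 2 * Real.log l + 52
            + 20 / 3 * Real.log (((2 ^ 12 * 3 ^ 3 * 5 * Cor22.dmod P : ℕ) : ℝ) * (l : ℝ))
              * (Nat.primeCounting (2 ^ 12 * 3 ^ 3 * 5 * Cor22.dmod P * l) : ℝ))))
    (T : Cor22.ThetaVolumeDatumAt P l) :
    T.HullEstimatePerImageOf
      (((l : ℝ) + 1) / 4 *
          ((1 + 12 * (Cor22.dmod P : ℝ) / l) * (P.logDiff + Cor22.logCondAvoid P {2, l})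
            + 2 * Real.log l + 52
            + 20 / 3 * Real.log (((2 ^ 12 * 3 ^ 3 * 5 * Cor22.dmod P : ℕ) : ℝ) * (l : ℝ))
              * (Nat.primeCounting (2 ^ 12 * 3 ^ 3 * 5 * Cor22.dmod P * l) : ℝ)) -
        (letI := T.instFieldF; letI := T.instNumberFieldF; letI := T.instFieldK; letI := T.instNumberFieldK
         letI := T.instAlgebraK
         T.I.X.slotResidue T.I.supportPrimes) +
        (2 * (Cor22.dmod P : ℝ) * (P.logDiff + Cor22.logCondAvoid P {2, l}) + Real.log (2 * 3 * 5 * (l : ℝ)))) := by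
  letI := T.instFieldF; letI := T.instNumberFieldF; letI := T.instAlgebraF; letI := T.instFieldK
  letI := T.instNumberFieldK; letI := T.instAlgebraK; letI := T.instFieldFbar; letI := T.instAlgebraFbar
  letI := T.instAlgebraKFbar; letI := T.instIsElliptic
  have hE := stepiii_const_nonneg hP T
  by_cases hc : ∀ p ∈ T.I.supportPrimes, ∀ v w : placesOver (fieldOfModuli T.E) p,
      (DHData.ofInput T.I).logQloc p v = (DHData.ofInput T.I).logQloc p w
  · -- slot-constant datum: residue `0`, the closed per-image line serves
    have hsc : ∀ p ∈ T.I.supportPrimes, ∀ (i : Fin T.I.X.lstar) (v w : placesOver (fieldOfModuli T.E) p),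
        T.I.X.slotValue i v.1 = T.I.X.slotValue i w.1 :=
      fun p hp => ((DHData.ofInput T.I).slotConstantAt_iff_logQloc_const p).mpr (hc p hp)
    have h0 : T.I.X.slotResidue T.I.supportPrimes = 0 := T.I.X.slotResidue_eq_zero_of_const _ hsc
    have hPI : T.I.HullEstimatePerImageOf
        (((l : ℝ) + 1) / 4 *
            ((1 + 12 * (Cor22.dmod P : ℝ) / l) * (P.logDiff + Cor22.logCondAvoid P {2, l})
              + 2 * Real.log l + 52
              + 20 / 3 * Real.log (((2 ^ 12 * 3 ^ 3 * 5 * Cor22.dmod P : ℕ) : ℝ) * (l : ℝ))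
                * (Nat.primeCounting (2 ^ 12 * 3 ^ 3 * 5 * Cor22.dmod P * l) : ℝ))) :=
      Summit.ABC.ABC.Theorems.ThetaPartII.hullVolumePerImageAtDatum_BIII hP hl h5 h6 T
    show T.I.HullEstimatePerImageOf _
    rw [h0, sub_zero]
    exact T.I.hullEstimatePerImageOf_mono hPI (le_add_of_nonneg_right hE)
  · -- off the regime: `hreg` gives the union estimate; lower the constant by the residue
    have hU := hregAt T hc
    have h1 : T.I.HullEstimatePerImageOf
        (((l : ℝ) + 1) / 4 *
            ((1 + 12 * (Cor22.dmod P : ℝ) / l) * (P.logDiff + Cor22.logCondAvoid P {2, l})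
              + 2 * Real.log l + 52
              + 20 / 3 * Real.log (((2 ^ 12 * 3 ^ 3 * 5 * Cor22.dmod P : ℕ) : ℝ) * (l : ℝ))
                * (Nat.primeCounting (2 ^ 12 * 3 ^ 3 * 5 * Cor22.dmod P * l) : ℝ)) -
          T.I.X.slotResidue T.I.supportPrimes + ∑ p ∈ T.I.supportPrimes, Real.log (p : ℝ)) :=
      T.I.hullEstimatePerImageOf_of_hullEstimateOf_residue hU
    have h2 : ∑ q ∈ T.I.supportPrimes, Real.log (q : ℝ) ≤
        2 * (Cor22.dmod P : ℝ) * (P.logDiff + Cor22.logCondAvoid P {2, l}) + Real.log (2 * 3 * 5 * (l : ℝ)) :=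
      T.sum_log_supportPrimes_le_pinned hP
    show T.I.HullEstimatePerImageOf _
    exact T.I.hullEstimatePerImageOf_mono h1 (add_le_add le_rfl h2)

/-- **Conversely**: «(ii′-P) at every datum with constant `B − slotResidue(T) − E(P,l)`» gives the union estimate `T.HullEstimateOf B` at EVERY
datum (`λ ∈ U_P` minimal) — a fortiori the `hreg` body at `(P, l)`. [cite: Mochizuki2012, IUTchIV Thm. 1.10 proof Steps (iii), (v) p. 26–28]
[claim: Mochizuki2012, status: disputed] -/
theorem hullRegimeAt_of_perImageLowered (hP : P ∈ UP) {B : ℝ}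
    (h : ∀ T : Cor22.ThetaVolumeDatumAt P l, T.HullEstimatePerImageOf (B -
        (letI := T.instFieldF; letI := T.instNumberFieldF; letI := T.instFieldK; letI := T.instNumberFieldK
         letI := T.instAlgebraK
         T.I.X.slotResidue T.I.supportPrimes) -
        (2 * (Cor22.dmod P : ℝ) * (P.logDiff + Cor22.logCondAvoid P {2, l}) + Real.log (2 * 3 * 5 * (l : ℝ)))))
    (T : Cor22.ThetaVolumeDatumAt P l) :
    (letI := T.instFieldF; letI := T.instNumberFieldF; letI := T.instAlgebraF; letI := T.instFieldK
     letI := T.instNumberFieldK; letI := T.instAlgebraK; letI := T.instFieldFbar; letI := T.instAlgebraFbar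
     letI := T.instAlgebraKFbar; letI := T.instIsElliptic
     ¬ (∀ p ∈ T.I.supportPrimes, ∀ v w : placesOver (fieldOfModuli T.E) p,
        (DHData.ofInput T.I).logQloc p v = (DHData.ofInput T.I).logQloc p w)) →
    T.HullEstimateOf B :=
  fun _ => (hullVolumeAtDatum_iff_perImage_lowered (l := l) hP (δ := B)).1 h T

end PointDict

/-! ## The v4 binder verbatim -/

namespace Conditional

open PointDict

/-- **`hreg` of `abc_of_S_v4` ⟹ «(ii′-P) with the constant lowered by the residue» at every datum of every admissible `(P, l)`.**
[cite: Mochizuki2012, IUTchIV Thm. 1.10 proof Steps (ii)–(viii) p. 24–31] [claim: Mochizuki2012, status: disputed] -/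
theorem perImageLowered_of_hreg
    (hreg : ∀ P : NFPoint, P ∈ UP → ∀ l : ℕ, l.Prime → 5 ≤ l →
      Cor22.AdmitsCore P → Cor22.CondP2 P l → Cor22.CondP5 P l → Cor22.CondP6 P l →
      ∀ T : Cor22.ThetaVolumeDatumAt P l,
        (letI := T.instFieldF; letI := T.instNumberFieldF; letI := T.instAlgebraF; letI := T.instFieldK
         letI := T.instNumberFieldK; letI := T.instAlgebraK; letI := T.instFieldFbar; letI := T.instAlgebraFbar
         letI := T.instAlgebraKFbar; letI := T.instIsElliptic
         ¬ (∀ p ∈ T.I.supportPrimes, ∀ v w : placesOver (fieldOfModuli T.E) p,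
            (Summit.ABC.IUTFork.DHData.ofInput T.I).logQloc p v = (Summit.ABC.IUTFork.DHData.ofInput T.I).logQloc p w)) →
        T.HullEstimateOf
          (((l : ℝ) + 1) / 4 *
            ((1 + 12 * (Cor22.dmod P : ℝ) / l) * (P.logDiff + Cor22.logCondAvoid P {2, l})
              + 2 * Real.log l + 52
              + 20 / 3 * Real.log (((2 ^ 12 * 3 ^ 3 * 5 * Cor22.dmod P : ℕ) : ℝ) * (l : ℝ))
                * (Nat.primeCounting (2 ^ 12 * 3 ^ 3 * 5 * Cor22.dmod P * l) : ℝ)))) :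
    ∀ P : NFPoint, P ∈ UP → ∀ l : ℕ, l.Prime → 5 ≤ l →
      Cor22.AdmitsCore P → Cor22.CondP2 P l → Cor22.CondP5 P l → Cor22.CondP6 P l →
      ∀ T : Cor22.ThetaVolumeDatumAt P l,
        T.HullEstimatePerImageOf
          (((l : ℝ) + 1) / 4 *
              ((1 + 12 * (Cor22.dmod P : ℝ) / l) * (P.logDiff + Cor22.logCondAvoid P {2, l})
                + 2 * Real.log l + 52
                + 20 / 3 * Real.log (((2 ^ 12 * 3 ^ 3 * 5 * Cor22.dmod P : ℕ) : ℝ) * (l : ℝ))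
                  * (Nat.primeCounting (2 ^ 12 * 3 ^ 3 * 5 * Cor22.dmod P * l) : ℝ)) -
            (letI := T.instFieldF; letI := T.instNumberFieldF; letI := T.instFieldK; letI := T.instNumberFieldK
             letI := T.instAlgebraK
             T.I.X.slotResidue T.I.supportPrimes) +
            (2 * (Cor22.dmod P : ℝ) * (P.logDiff + Cor22.logCondAvoid P {2, l}) + Real.log (2 * 3 * 5 * (l : ℝ)))) :=
  fun P hP l hl h5 hc h2 h5' h6 T => perImageLowered_of_hullRegimeAt hP hl h5 h6 (hreg P hP l hl h5 hc h2 h5' h6) T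

/-- **Conversely «(ii′-P) with constant `B_III − slotResidue(T) − E(P,l)` at every admissible datum» ⟹ `hreg` of `abc_of_S_v4` VERBATIM** (indeed
the stronger `hvol` of `abc_of_S_v3`; the regime hypothesis is not used). [cite: Mochizuki2012, IUTchIV Thm. 1.10 proof Steps (iii), (v) p. 26–28]
[claim: Mochizuki2012, status: disputed] -/
theorem hreg_of_perImageLowered
    (h : ∀ P : NFPoint, P ∈ UP → ∀ l : ℕ, l.Prime → 5 ≤ l →
      Cor22.AdmitsCore P → Cor22.CondP2 P l → Cor22.CondP5 P l → Cor22.CondP6 P l →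
      ∀ T : Cor22.ThetaVolumeDatumAt P l,
        T.HullEstimatePerImageOf
          (((l : ℝ) + 1) / 4 *
              ((1 + 12 * (Cor22.dmod P : ℝ) / l) * (P.logDiff + Cor22.logCondAvoid P {2, l})
                + 2 * Real.log l + 52
                + 20 / 3 * Real.log (((2 ^ 12 * 3 ^ 3 * 5 * Cor22.dmod P : ℕ) : ℝ) * (l : ℝ))
                  * (Nat.primeCounting (2 ^ 12 * 3 ^ 3 * 5 * Cor22.dmod P * l) : ℝ)) -
            (letI := T.instFieldF; letI := T.instNumberFieldF; letI := T.instFieldK; letI := T.instNumberFieldK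
             letI := T.instAlgebraK
             T.I.X.slotResidue T.I.supportPrimes) -
            (2 * (Cor22.dmod P : ℝ) * (P.logDiff + Cor22.logCondAvoid P {2, l}) + Real.log (2 * 3 * 5 * (l : ℝ))))) :
    ∀ P : NFPoint, P ∈ UP → ∀ l : ℕ, l.Prime → 5 ≤ l →
      Cor22.AdmitsCore P → Cor22.CondP2 P l → Cor22.CondP5 P l → Cor22.CondP6 P l →
      ∀ T : Cor22.ThetaVolumeDatumAt P l,
        (letI := T.instFieldF; letI := T.instNumberFieldF; letI := T.instAlgebraF; letI := T.instFieldK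
         letI := T.instNumberFieldK; letI := T.instAlgebraK; letI := T.instFieldFbar; letI := T.instAlgebraFbar
         letI := T.instAlgebraKFbar; letI := T.instIsElliptic
         ¬ (∀ p ∈ T.I.supportPrimes, ∀ v w : placesOver (fieldOfModuli T.E) p,
            (Summit.ABC.IUTFork.DHData.ofInput T.I).logQloc p v = (Summit.ABC.IUTFork.DHData.ofInput T.I).logQloc p w)) →
        T.HullEstimateOf
          (((l : ℝ) + 1) / 4 *
            ((1 + 12 * (Cor22.dmod P : ℝ) / l) * (P.logDiff + Cor22.logCondAvoid P {2, l})
              + 2 * Real.log l + 52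
              + 20 / 3 * Real.log (((2 ^ 12 * 3 ^ 3 * 5 * Cor22.dmod P : ℕ) : ℝ) * (l : ℝ))
                * (Nat.primeCounting (2 ^ 12 * 3 ^ 3 * 5 * Cor22.dmod P * l) : ℝ))) :=
  fun P hP l hl h5 hc h2 h5' h6 T hT =>
    hullRegimeAt_of_perImageLowered hP (h P hP l hl h5 hc h2 h5' h6) T hT

end Conditional

end Summit.ABC.IUTFork

end
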